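import Mathlib
import Literature.Computability.AlgebraicComplexity.BD17RealExponentDescartesRule
import Summits.ValiantsHypothesis.ValiantsHypothesis.Theorems.LacunarySymmetroidDoorA26ExtremalInverseDefs
import Summits.ValiantsHypothesis.ValiantsHypothesis.Theorems.LacunarySymmetroidDoorA26ExtremalInverseStubExtremalInverse

/-!
# Route `LacunarySymmetroid` — crux `DoorA26` (stmt-ValiantsHypothesis-19979), line «inverse-door» (negation face of
# «extremal-inverse»): stub `stub_prescribedToPencil` (prescribed roots of a symmetroid Gram are pencil roots), VERBATIM

Line `Cruxes/DoorA26/Lines/inverse_door.lean` (ideator val-idea-4 g2, D-0145) is the NEGATION FACE of line «extremal-inverse»: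
it composes `¬ DoorA26` from a twenty-root witness (`stub_witness20`, a SEARCH TARGET, open) and the register `ζ_sym(2,6) ≥ 19`
from a nineteen-root witness (`stub_witness19`, open), both through the support stub `stub_prescribedToPencil` — THIS FILE,
proved with exactly the registered signature in the Theorems-side copy of the line's vocabulary (`…DoorA26ExtremalInverseDefs`:
`gramFn`, `IsSidon`, `IsSymmetroidGram`, `PrescribedWitness`, same bodies as the skeleton's):

* `stub_prescribedToPencil : ∀ n, PrescribedWitness n → ∃ δ S, (∀ l, (S l).IsSymm) ∧ n ≤ #{x > 0 : det (Σ_l x^{δ_l} S_l) = 0}`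
  — `n` prescribed positive roots of a NONZERO symmetroid Gram `M = v vᵀ − u uᵀ − w wᵀ` on a Sidon real support are `n`
  positive zeros of a real symmetric `2 × 2` real-exponent pencil (the currency of `Census.RealExp.not_posRootLawAt_iff_all`).

PROOF.  (1) `det_pencil_eq_gramFn`: with `S_l = [[v_l + u_l, w_l], [w_l, v_l − u_l]]`,
`det (Σ_l x^{δ_l} S_l) = gramFn δ M x` for `x > 0` (expand the `2 × 2` determinant; `x^{δᵢ} x^{δⱼ} = x^{δᵢ+δⱼ}`; the
antisymmetric part `Σ_{i,j} x^{δᵢ+δⱼ}(uᵢvⱼ − vᵢuⱼ)` vanishes, `sum_sum_rpow_mul_antisymm_eq_zero`).  (2) Sort the `21` distinct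
pair sums of the Sidon support (`ExtremalInverse.exists_sortedEnum` of the companion file) and regroup `gramFn δ M` as the
real-exponent fewnomial `Σ_k a_k x^{E_k}` (`gramFn_eq_linComb`), whose coefficients `a_{σ i j} ∈ {M i i, 2 M i j}`
(`filter_sigma_eq_pair`) do not all vanish since `M ≠ 0` is symmetric (`coeffVec_ne_zero`).  (3) Descartes' rule of signs for
REAL exponents, in the tree as `Literature.Computability.AlgebraicComplexity.BD17.satisfiesDescartesRule_rpow` (Bihan–Dickenstein
2017 §4.1), makes the positive zero set finite; the strictly increasing `r` injects the `n` prescribed roots into it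
(`Set.ncard_le_ncard_of_injOn`).

HONEST FRAMING.  One support stub (size M; no new mathematics) of the negation-face line of an OPEN crux; it closes NO item
(`--supports stmt-ValiantsHypothesis-19979`, helper).  The line's bets `stub_witness20` / `stub_witness19` are SEARCH TARGETS and
untouched; `DoorA26` stays open and is asserted nowhere; nothing bears on `MatrixDescartes` (stmt-ValiantsHypothesis-18050),
Conjecture B, or `VP ≠ VNP`.  Width seat val-width-19979-ei1 (cell valiant-width), 2026-08-28.
-/

-- `Summit.ValiantsHypothesis.ValiantsHypothesis.…` repeats a component by the D-0017 layout
-- (single-conjunct summit), which the `dupNamespace` linter flags; the name is mandated.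
set_option linter.dupNamespace false

namespace Summit.ValiantsHypothesis.ValiantsHypothesis.Theorems.LacunarySymmetroid.DoorA26.InverseDoor

open Matrix Finset
open scoped BigOperators
open Literature.Computability.AlgebraicComplexity (BD17.linComb BD17.satisfiesDescartesRule_rpow)

/-! ### 1. The pencil of a symmetroid Gram and its determinant -/

/-- The antisymmetric part of `a cᵀ` cancels in the double sum: `Σ_{i,j} x^{δᵢ+δⱼ} (uᵢ vⱼ − vᵢ uⱼ) = 0`. [folklore] -/
theorem sum_sum_rpow_mul_antisymm_eq_zero (δ v u : Fin 6 → ℝ) (x : ℝ) :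
    ∑ i, ∑ j, x ^ (δ i + δ j) * (u i * v j - v i * u j) = 0 := by
  have h := Finset.sum_comm (s := (Finset.univ : Finset (Fin 6))) (t := (Finset.univ : Finset (Fin 6)))
    (f := fun i j => x ^ (δ i + δ j) * (u i * v j - v i * u j))
  have h2 : ∑ j, ∑ i, x ^ (δ i + δ j) * (u i * v j - v i * u j) =
      -∑ j, ∑ i, x ^ (δ j + δ i) * (u j * v i - v j * u i) := by
    rw [← Finset.sum_neg_distrib]
    refine Finset.sum_congr rfl fun j _ => ?_
    rw [← Finset.sum_neg_distrib]
    refine Finset.sum_congr rfl fun i _ => ?_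
    rw [add_comm (δ i) (δ j)]
    ring
  linarith [h, h2]

/-- **The Gram form over a real support.**  For `x > 0` the determinant of the symmetric `2 × 2` real-exponent pencil
`Σ_l x^{δ_l} [[v_l + u_l, w_l], [w_l, v_l − u_l]]` is the quadratic-form fewnomial `gramFn δ (v vᵀ − u uᵀ − w wᵀ) x`
(expand the `2 × 2` determinant of the sum; the antisymmetric part of `a cᵀ` cancels). [folklore] -/
theorem det_pencil_eq_gramFn (δ v u w : Fin 6 → ℝ) {x : ℝ} (hx : 0 < x) :
    (∑ l, (x ^ (δ l)) • !![v l + u l, w l; w l, v l - u l]).det =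
      gramFn δ (Matrix.vecMulVec v v - Matrix.vecMulVec u u - Matrix.vecMulVec w w) x := by
  have hentry : ∀ i j, (∑ l, (x ^ (δ l)) • !![v l + u l, w l; w l, v l - u l]) i j
      = ∑ l, x ^ (δ l) * (!![v l + u l, w l; w l, v l - u l] i j) := by
    intro i j
    simp only [Matrix.sum_apply, Matrix.smul_apply, smul_eq_mul]
  rw [Matrix.det_fin_two, hentry, hentry, hentry, hentry]
  simp only [Matrix.of_apply, Matrix.cons_val', Matrix.cons_val_zero, Matrix.cons_val_one,
    Matrix.empty_val', Matrix.cons_val_fin_one]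
  rw [Finset.sum_mul_sum, Finset.sum_mul_sum, ← Finset.sum_sub_distrib]
  unfold gramFn
  rw [← sub_eq_zero, ← Finset.sum_sub_distrib]
  calc ∑ i, (∑ j, x ^ δ i * (v i + u i) * (x ^ δ j * (v j - u j)) - ∑ j, x ^ δ i * w i * (x ^ δ j * w j) -
          ∑ j, (Matrix.vecMulVec v v - Matrix.vecMulVec u u - Matrix.vecMulVec w w) i j * x ^ (δ i + δ j))
      = ∑ i, ∑ j, x ^ (δ i + δ j) * (u i * v j - v i * u j) := by
        refine Finset.sum_congr rfl fun i _ => ?_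
        rw [← Finset.sum_sub_distrib, ← Finset.sum_sub_distrib]
        refine Finset.sum_congr rfl fun j _ => ?_
        simp only [Matrix.sub_apply, Matrix.vecMulVec_apply]
        rw [Real.rpow_add hx]
        ring
    _ = 0 := sum_sum_rpow_mul_antisymm_eq_zero δ v u x

/-! ### 2. Regrouping along the sorted Sidon support; the coefficient vector -/

/-- Regrouping the quadratic-form rpow-fewnomial along a position map `σ` into the sorted exponent list `E`
(`E (σ i j) = δᵢ + δⱼ`): `gramFn δ M = Σ_k a_k x^{E_k}` with `a_k = Σ_{σ(i,j) = k} M i j`. [folklore] -/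
theorem gramFn_eq_linComb (δ : Fin 6 → ℝ) (M : Matrix (Fin 6) (Fin 6) ℝ) (E : Fin 21 → ℝ)
    (σ : Fin 6 → Fin 6 → Fin 21) (hEσ : ∀ i j, E (σ i j) = δ i + δ j) (y : ℝ) :
    gramFn δ M y = BD17.linComb
      (fun k => ∑ p ∈ Finset.univ.filter (fun p : Fin 6 × Fin 6 => σ p.1 p.2 = k), M p.1 p.2)
      (fun k x => x ^ E k) y := by
  classical
  unfold gramFn BD17.linComb
  rw [← Fintype.sum_prod_type', ← Finset.sum_fiberwise Finset.univ (fun p : Fin 6 × Fin 6 => σ p.1 p.2)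
    (fun p : Fin 6 × Fin 6 => M p.1 p.2 * y ^ (δ p.1 + δ p.2))]
  refine Finset.sum_congr rfl fun k _ => ?_
  rw [Finset.sum_mul]
  refine Finset.sum_congr rfl fun p hp => ?_
  beta_reduce
  rw [← (Finset.mem_filter.mp hp).2, hEσ]

/-- On a Sidon support the fibre of the position map over `σ i j` is the unordered pair `{(i,j), (j,i)}`. [folklore] -/
theorem filter_sigma_eq_pair (δ : Fin 6 → ℝ) (hδ : IsSidon δ) (E : Fin 21 → ℝ) (σ : Fin 6 → Fin 6 → Fin 21)
    (hE : StrictMono E) (hEσ : ∀ i j, E (σ i j) = δ i + δ j) (i j : Fin 6) :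
    (Finset.univ.filter fun p : Fin 6 × Fin 6 => σ p.1 p.2 = σ i j) = {(i, j), (j, i)} := by
  ext p
  simp only [Finset.mem_filter, Finset.mem_univ, true_and, Finset.mem_insert, Finset.mem_singleton]
  constructor
  · intro h
    have h' : δ p.1 + δ p.2 = δ i + δ j := by rw [← hEσ, ← hEσ, h]
    rcases hδ p.1 p.2 i j h' with ⟨h1, h2⟩ | ⟨h1, h2⟩
    · exact Or.inl (Prod.ext h1 h2)
    · exact Or.inr (Prod.ext h1 h2)
  · rintro (rfl | rfl)
    · rfl
    · exact hE.injective (by rw [hEσ, hEσ, add_comm])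

/-- The regrouped coefficient vector of a nonzero symmetric `M` on a Sidon support is nonzero (its entries are `M i i` and
`2 M i j`). [folklore] -/
theorem coeffVec_ne_zero (δ : Fin 6 → ℝ) (hδ : IsSidon δ) {M : Matrix (Fin 6) (Fin 6) ℝ}
    (hMsymm : ∀ i j, M j i = M i j) (hM0 : M ≠ 0) (E : Fin 21 → ℝ) (σ : Fin 6 → Fin 6 → Fin 21)
    (hE : StrictMono E) (hEσ : ∀ i j, E (σ i j) = δ i + δ j) :
    (fun k => ∑ p ∈ Finset.univ.filter (fun p : Fin 6 × Fin 6 => σ p.1 p.2 = k), M p.1 p.2) ≠ 0 := by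
  classical
  intro h
  apply hM0
  ext i j
  have hk := congrFun h (σ i j)
  simp only [Pi.zero_apply] at hk
  rw [filter_sigma_eq_pair δ hδ E σ hE hEσ i j] at hk
  rw [Matrix.zero_apply]
  by_cases hij : i = j
  · subst hij
    rwa [Finset.pair_eq_singleton, Finset.sum_singleton] at hk
  · have hne : (i, j) ≠ (j, i) := fun e => hij (congrArg Prod.fst e)
    rw [Finset.sum_pair hne, hMsymm i j] at hk
    linarith

/-! ### 3. The stub -/

/-- **Stub `stub_prescribedToPencil` of line «inverse-door» (crux `DoorA26`, stmt-ValiantsHypothesis-19979), verbatim: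
prescribed roots of a symmetroid Gram are pencil roots.**  From `M = v vᵀ − u uᵀ − w wᵀ ≠ 0` on a Sidon real support
`δ` vanishing (as the rpow-fewnomial `gramFn δ M`) at `n` prescribed points `0 < r₀ < ⋯ < r_{n−1}`, build the symmetric
blocks `S_l = [[v_l + u_l, w_l], [w_l, v_l − u_l]]`: then `det (Σ_l x^{δ_l} S_l) = gramFn δ M x` for `x > 0`
(`det_pencil_eq_gramFn`), and `gramFn δ M` regrouped along the sorted Sidon support is a real-exponent fewnomial with
`21` distinct exponents and a NONZERO coefficient vector (`M i i`, `2 M i j`), so its positive zero set is finite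
(Descartes' rule for real exponents, `Literature.Computability.AlgebraicComplexity.BD17.satisfiesDescartesRule_rpow`,
Bihan–Dickenstein 2017 §4.1) and contains the `n` prescribed roots: `n ≤ ncard`. [folklore] -/
theorem stub_prescribedToPencil :
    ∀ n : ℕ, PrescribedWitness n →
      ∃ (δ : Fin 6 → ℝ) (S : Fin 6 → Matrix (Fin 2) (Fin 2) ℝ),
        (∀ l, (S l).IsSymm) ∧ n ≤ {x : ℝ | 0 < x ∧ (∑ l, (x ^ (δ l)) • S l).det = 0}.ncard := by
  classical
  rintro n ⟨δ, M, r, hδ, ⟨v, u, w, hM⟩, hM0, hr, hpos, hzero⟩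
  refine ⟨δ, fun l => !![v l + u l, w l; w l, v l - u l], fun l => ?_, ?_⟩
  · -- the blocks are symmetric
    ext i j
    fin_cases i <;> fin_cases j <;> rfl
  -- sorted enumeration of the Sidon support and the regrouped coefficient vector
  obtain ⟨E, σ, hE, -, hEσ, -⟩ :=
    ExtremalInverse.exists_sortedEnum (fun i j => δ i + δ j) (fun i j => add_comm _ _) hδ
  set a : Fin 21 → ℝ := fun k => ∑ p ∈ Finset.univ.filter (fun p : Fin 6 × Fin 6 => σ p.1 p.2 = k), M p.1 p.2
    with ha
  have hMsymm : ∀ i j, M j i = M i j := by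
    intro i j
    rw [hM]
    simp only [Matrix.sub_apply, Matrix.vecMulVec_apply]
    ring
  have ha0 : a ≠ 0 := coeffVec_ne_zero δ hδ hMsymm hM0 E σ hE hEσ
  -- Descartes' rule for real exponents: the positive zero set of `Σ_k a_k x^{E_k}` is finite
  have hfin := (BD17.satisfiesDescartesRule_rpow E hE a ha0).1
  -- the zero set of the pencil determinant on `(0, ∞)` is that zero set
  have hZ : {x : ℝ | 0 < x ∧ (∑ l, (x ^ (δ l)) • !![v l + u l, w l; w l, v l - u l]).det = 0} =
      {y | y ∈ Set.Ioi (0 : ℝ) ∧ BD17.linComb a (fun k x => x ^ E k) y = 0} := by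
    ext x
    simp only [Set.mem_setOf_eq, Set.mem_Ioi]
    refine and_congr_right fun hx => ?_
    rw [det_pencil_eq_gramFn δ v u w hx, ← hM, gramFn_eq_linComb δ M E σ hEσ]
  rw [hZ]
  -- the `n` prescribed roots inject into it
  have hmem : ∀ b ∈ (Set.univ : Set (Fin n)), r b ∈
      {y | y ∈ Set.Ioi (0 : ℝ) ∧ BD17.linComb a (fun k x => x ^ E k) y = 0} := by
    intro b _
    refine ⟨hpos b, ?_⟩
    rw [← gramFn_eq_linComb δ M E σ hEσ]
    exact hzero b
  calc n = (Set.univ : Set (Fin n)).ncard := by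
        rw [Set.ncard_univ, Nat.card_eq_fintype_card, Fintype.card_fin]
    _ ≤ _ := Set.ncard_le_ncard_of_injOn r hmem (hr.injective.injOn) hfin

end Summit.ValiantsHypothesis.ValiantsHypothesis.Theorems.LacunarySymmetroid.DoorA26.InverseDoor
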